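import Literature.NumberTheory.Adeles.CompactSubgroupStabilisesLattice
import Literature.AlgebraicGeometry.ModuliOfAbelianVarieties.SiegelShimuraSet
import HarnessLib

/-!
# Transporting an INTEGER endomorphism reading along a rational mover `q ∈ GSp_δ(ℚ)`: `ρ ↦ q⁻¹ρq` stays integral, keeps Rosati,
# and its real avatar is the `(q_ℝ)⁻¹`-conjugate (Siegel side of the unitary-curve chart's (M) fields)

Topic `AlgebraicGeometry/ModuliOfAbelianVarieties`; namespace `Literature.AlgebraicGeometry.ModuliOfAbelianVarieties`.
Theorems only (no definition, no named fact, no instance).  Cell `hodgecm-mathlib` (D-0151), FLOOR 0, P6 «MOD programme», door (E) of `stub_RGD`,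
organ **E1 FILE 8** (A-p01 (g26), 2026-09-01) — the junction of ★ E1 FILE 7b (`ρ : 𝓞 M →+* M_{2g}(ℤ)`, `UnitaryCurveAuxiliaryIntegralActionV`) and
★ E3 FILE D (the movers `q_a`, `UnitaryCurveSiegelChartMover`): the E-line chart `AuxChartGS` of `Cruxes/HLiu418/Lines/F0_P6a_PELWitnessE.lean` reads the
`𝒪_F`-action at the adelic representative `a` in the marking `(Z_a v, rep (piece a))` of the image point, i.e. as the conjugate `q_a⁻¹ ρ(b) q_a`
(`Mρ a`), which is INTEGRAL because `q_a · rep = b(a) · κ` (`κ ∈ K_δ(N)`) and `ρ(b)` commutes with `b(a)`; Rosati survives (`q` is a symplectic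
similitude) and Kottwitz reads through the real avatar `(q_ℝ)⁻¹ (ρ b)_ℝ q_ℝ` (★ E2 FILE D `exists_lieAction_charpoly` at `γ = (q_ℝ)⁻¹`).
Generic in the source ring `O` of the reading.  `--supports stmt-HodgeConjecture-24832`, count-neutral; HC_CM is proved only modulo the printed
citations until rung 0 closes.

* §1 bridges: integer adelic matrices are `≡ 1 (mod 1·𝒪̂)`; a rational matrix which is adelically `≡ 1 (mod 𝒪̂)` is integral.
* §2 `forall_exists_intCast_conj_of_smul_mk_eq` — for an integer `X` commuting with `B ∈ GSp_δ(𝔸_f)` and a mover `q ∈ GSp_δ(ℚ)` with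
  `q_f • (r K) = (B K)`, `r ∈ K_δ(1)`, `K ≤ K_δ(1)`: `q⁻¹ X q ∈ M_{2g}(ℤ)`.
* §3 `exists_ringHom_conj_of_smul_mk_eq` — the same for a ring homomorphism `ρ : O →+* M_{2g}(ℤ)`: `∃ ρ' : O →+* M_{2g}(ℤ)`,
  `(ρ' b)_ℚ = q⁻¹ (ρ b)_ℚ q`.
* §4 `conj_reading_transpose_mul_typeForm` — ROSATI transports: `(ρ b')ᵀ E = E ρ b ⇒ (ρ' b')ᵀ E = E ρ' b`.
* §5 `conj_reading_map_real` — `(ρ' b)_ℝ = γ (ρ b)_ℝ γ⁻¹` with `γ = (q_ℝ)⁻¹ ∈ GSp_δ(ℝ)`, and `conj_reading_mul_conjJ_comm` — if `(ρ b)_ℝ` commutes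
  with `J` then `(ρ' b)_ℝ` commutes with `conjJ γ J`.

## References
* [Milne2005ShimuraVarieties] J. S. Milne, *Introduction to Shimura varieties* (2005), Lemma 5.13 p. 57, §6 pp. 67–70, Thm. 6.11 p. 74.
* [Kottwitz1992] R. Kottwitz, *Points on some Shimura varieties over finite fields*, JAMS 5 (1992), §5 p. 390.
* [RapoportSmithlingZhang2020Diagonal] M. Rapoport, B. Smithling, W. Zhang (2020), §4.1 p. 17.
* [PlatonovRapinchuk1994] V. Platonov, A. Rapinchuk, *Algebraic groups and number theory* (1994), §8.1.
-/

set_option autoImplicit false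

noncomputable section

open Matrix NumberField IsDedekindDomain
open Literature.NumberTheory.Automorphic (integralFiniteAdeles)
open Literature.NumberTheory.Adeles (exists_int_cast_eq_of_mem_integralFiniteAdeles algebraMap_intCast_mem_integralFiniteAdeles)

namespace Literature.AlgebraicGeometry.ModuliOfAbelianVarieties

variable {g : ℕ} {δ : Fin g → ℕ}

/-! ### §1. Bridges between the two integrality currencies -/

section Bridges

variable {n : Type} [Fintype n] [DecidableEq n]

/-- The range spelling `𝒪̂ = range (∏_v 𝒪_v → 𝔸_f)` implies the pointwise spelling. [cite: PlatonovRapinchuk1994, §8.1] -/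
private theorem mem_integralFiniteAdeles_of_mem_integralAdeles {x : finAdeleQ} (hx : x ∈ FiniteAdeleRing.integralAdeles (𝓞 ℚ) ℚ) :
    x ∈ integralFiniteAdeles ℚ := by
  obtain ⟨y, rfl⟩ := hx
  intro v
  exact (y v).2

/-- The pointwise spelling implies the range spelling. [cite: PlatonovRapinchuk1994, §8.1] -/
private theorem mem_integralAdeles_of_mem_integralFiniteAdeles {x : finAdeleQ} (hx : x ∈ integralFiniteAdeles ℚ) :
    x ∈ FiniteAdeleRing.integralAdeles (𝓞 ℚ) ℚ :=
  ⟨fun v => ⟨x v, hx v⟩, FiniteAdeleRing.ext _ fun _ => rfl⟩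

omit [Fintype n] in
/-- **An integer matrix, read adelically, is `≡ 1 (mod 1·𝒪̂)`** (i.e. `𝒪̂`-integral). [cite: Milne2005ShimuraVarieties, §6 p. 70] -/
theorem isCongOne_one_map_intCast (X : Matrix n n ℤ) : IsCongOne 1 (X.map (Int.cast : ℤ → finAdeleQ)) := by
  intro i j
  rw [mem_levelIdeal_iff]
  refine ⟨(X.map (Int.cast : ℤ → finAdeleQ) - 1) i j, mem_integralAdeles_of_mem_integralFiniteAdeles ?_, by rw [Nat.cast_one, one_mul]⟩
  rw [Matrix.sub_apply, Matrix.map_apply]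
  refine sub_mem ?_ ?_
  · have h := algebraMap_intCast_mem_integralFiniteAdeles (X i j)
    rwa [map_intCast] at h
  · rw [Matrix.one_apply]
    split_ifs
    · exact one_mem _
    · exact zero_mem _

omit [Fintype n] in
/-- **A rational matrix which is adelically `≡ 1 (mod 1·𝒪̂)` is an integer matrix** (`ℚ ∩ 𝒪̂ = ℤ`). [cite: PlatonovRapinchuk1994, §8.1] -/
theorem forall_exists_intCast_of_isCongOne_one_map (Y : Matrix n n ℚ) (h : IsCongOne 1 (Y.map (algebraMap ℚ finAdeleQ))) :
    ∀ i j, ∃ z : ℤ, Y i j = (z : ℚ) := by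
  intro i j
  have hij : algebraMap ℚ finAdeleQ (Y i j) ∈ integralFiniteAdeles ℚ := by
    have h1 := mem_integralAdeles_of_mem_levelIdeal (h i j)
    rw [Matrix.sub_apply, Matrix.map_apply] at h1
    have h2 : algebraMap ℚ finAdeleQ (Y i j) = (algebraMap ℚ finAdeleQ (Y i j) - (1 : Matrix n n finAdeleQ) i j) + (1 : Matrix n n finAdeleQ) i j :=
      (sub_add_cancel _ _).symm
    rw [h2]
    refine add_mem (mem_integralFiniteAdeles_of_mem_integralAdeles h1) ?_
    rw [Matrix.one_apply]
    split_ifs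
    · exact one_mem _
    · exact zero_mem _
  obtain ⟨z, hz⟩ := exists_int_cast_eq_of_mem_integralFiniteAdeles hij
  exact ⟨z, hz.symm⟩

end Bridges

/-! ### §2. The conjugate of an integer matrix along a mover is an integer matrix -/

section Core

/-- **`q⁻¹ X q ∈ M_{2g}(ℤ)`** for an INTEGER matrix `X` commuting with the adelic point `B ∈ GSp_δ(𝔸_f)` and a rational mover `q ∈ GSp_δ(ℚ)` with
`q_f • (r K) = (B K)` (`r ∈ K_δ(1)`, `K ≤ K_δ(1)`): indeed `B = q_f · r · κ` (`κ ∈ K`), so adelically `q⁻¹ X q = (rκ) X (rκ)⁻¹ ≡ 1·𝒪̂`-integral, and a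
rational `𝒪̂`-integral matrix is integral. [cite: Milne2005ShimuraVarieties, Lemma 5.13 p. 57, Thm. 6.11 p. 74] [cite: Kottwitz1992, §5 p. 390] -/
theorem forall_exists_intCast_conj_of_smul_mk_eq (X : Matrix (Fin g ⊕ Fin g) (Fin g ⊕ Fin g) ℤ) (q : ↥(gspRational δ))
    (B r : ↥(gspFinAdelic δ)) (K : Subgroup ↥(gspFinAdelic δ)) (hK : K ≤ principalLevelSubgroup δ 1) (hr : r ∈ principalLevelSubgroup δ 1)
    (hq : gspRationalToFinAdelic δ q • ((r : ↥(gspFinAdelic δ)) : ↥(gspFinAdelic δ) ⧸ K) = ((B : ↥(gspFinAdelic δ)) : ↥(gspFinAdelic δ) ⧸ K))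
    (hcomm : X.map (Int.cast : ℤ → finAdeleQ) * ((B : GL (Fin g ⊕ Fin g) finAdeleQ) : Matrix (Fin g ⊕ Fin g) (Fin g ⊕ Fin g) finAdeleQ) =
      ((B : GL (Fin g ⊕ Fin g) finAdeleQ) : Matrix (Fin g ⊕ Fin g) (Fin g ⊕ Fin g) finAdeleQ) * X.map (Int.cast : ℤ → finAdeleQ)) :
    ∀ i j, ∃ z : ℤ,
      ((((q⁻¹ : ↥(gspRational δ)) : GL (Fin g ⊕ Fin g) ℚ) : Matrix (Fin g ⊕ Fin g) (Fin g ⊕ Fin g) ℚ) * X.map (Int.cast : ℤ → ℚ) *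
          (((q : ↥(gspRational δ)) : GL (Fin g ⊕ Fin g) ℚ) : Matrix (Fin g ⊕ Fin g) (Fin g ⊕ Fin g) ℚ)) i j = (z : ℚ) := by
  -- `κ := (q_f r)⁻¹ B ∈ K` and `W := r κ ∈ K_δ(1)` with `B = q_f W`
  set qf : ↥(gspFinAdelic δ) := gspRationalToFinAdelic δ q with hqf
  have hκ : (qf * r)⁻¹ * B ∈ K := by
    rw [MulAction.Quotient.smul_mk, smul_eq_mul, QuotientGroup.eq] at hq
    exact hq
  set W : ↥(gspFinAdelic δ) := r * ((qf * r)⁻¹ * B) with hW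
  have hW1 : W ∈ principalLevelSubgroup δ 1 := Subgroup.mul_mem _ hr (hK hκ)
  have hBW : B = qf * W := by rw [hW, ← mul_assoc, mul_inv_cancel_left]
  -- matrices
  set f : ℚ →+* finAdeleQ := algebraMap ℚ finAdeleQ with hf
  set Xa : Matrix (Fin g ⊕ Fin g) (Fin g ⊕ Fin g) finAdeleQ := X.map (Int.cast : ℤ → finAdeleQ) with hXa
  set qm : Matrix (Fin g ⊕ Fin g) (Fin g ⊕ Fin g) ℚ := (((q : ↥(gspRational δ)) : GL (Fin g ⊕ Fin g) ℚ) : Matrix (Fin g ⊕ Fin g) (Fin g ⊕ Fin g) ℚ) with hqm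
  set qi : Matrix (Fin g ⊕ Fin g) (Fin g ⊕ Fin g) ℚ := (((q⁻¹ : ↥(gspRational δ)) : GL (Fin g ⊕ Fin g) ℚ) : Matrix (Fin g ⊕ Fin g) (Fin g ⊕ Fin g) ℚ) with hqi
  have hqfm : (((qf : ↥(gspFinAdelic δ)) : GL (Fin g ⊕ Fin g) finAdeleQ) : Matrix (Fin g ⊕ Fin g) (Fin g ⊕ Fin g) finAdeleQ) = qm.map f := rfl
  have hqfi : (((qf⁻¹ : ↥(gspFinAdelic δ)) : GL (Fin g ⊕ Fin g) finAdeleQ) : Matrix (Fin g ⊕ Fin g) (Fin g ⊕ Fin g) finAdeleQ) = qi.map f := by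
    rw [hqf, ← map_inv]; rfl
  set Wm : Matrix (Fin g ⊕ Fin g) (Fin g ⊕ Fin g) finAdeleQ := (((W : ↥(gspFinAdelic δ)) : GL (Fin g ⊕ Fin g) finAdeleQ) : Matrix (Fin g ⊕ Fin g) (Fin g ⊕ Fin g) finAdeleQ)
    with hWm
  set Wi : Matrix (Fin g ⊕ Fin g) (Fin g ⊕ Fin g) finAdeleQ := (((W⁻¹ : ↥(gspFinAdelic δ)) : GL (Fin g ⊕ Fin g) finAdeleQ) : Matrix (Fin g ⊕ Fin g) (Fin g ⊕ Fin g) finAdeleQ)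
    with hWi
  set Bm : Matrix (Fin g ⊕ Fin g) (Fin g ⊕ Fin g) finAdeleQ := (((B : ↥(gspFinAdelic δ)) : GL (Fin g ⊕ Fin g) finAdeleQ) : Matrix (Fin g ⊕ Fin g) (Fin g ⊕ Fin g) finAdeleQ)
    with hBm
  set Bi : Matrix (Fin g ⊕ Fin g) (Fin g ⊕ Fin g) finAdeleQ := (((B⁻¹ : ↥(gspFinAdelic δ)) : GL (Fin g ⊕ Fin g) finAdeleQ) : Matrix (Fin g ⊕ Fin g) (Fin g ⊕ Fin g) finAdeleQ)
    with hBi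
  have hBiBm : Bi * Bm = 1 := by rw [hBi, hBm, Subgroup.coe_inv, Units.inv_mul]
  -- `q_f⁻¹ = W B⁻¹`, `q_f = B W⁻¹`
  have hqfW : qf = B * W⁻¹ := by rw [hBW, mul_inv_cancel_right]
  have hqfiW : qf⁻¹ = W * B⁻¹ := by rw [hqfW, _root_.mul_inv_rev, inv_inv]
  have hqi' : qi.map f = Wm * Bi := by
    rw [← hqfi, hqfiW, Subgroup.coe_mul, Units.val_mul]
  have hqm' : qm.map f = Bm * Wi := by
    rw [← hqfm]
    conv_lhs => rw [hqfW]
    rw [Subgroup.coe_mul, Units.val_mul]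
  -- the adelic image of `q⁻¹ X q` is `W X W⁻¹`
  have hXcast : (X.map (Int.cast : ℤ → ℚ)).map f = Xa := by
    rw [hXa, Matrix.map_map]
    congr 1
    funext z
    simp only [Function.comp_apply, map_intCast]
  have hconj : (qi * X.map (Int.cast : ℤ → ℚ) * qm).map f = Wm * Xa * Wi := by
    rw [← RingHom.mapMatrix_apply, map_mul, map_mul, RingHom.mapMatrix_apply, RingHom.mapMatrix_apply, RingHom.mapMatrix_apply,
      hqi', hqm', hXcast]
    calc Wm * Bi * Xa * (Bm * Wi) = Wm * (Bi * (Xa * Bm)) * Wi := by simp only [Matrix.mul_assoc]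
      _ = Wm * (Bi * (Bm * Xa)) * Wi := by rw [hcomm]
      _ = Wm * Xa * Wi := by rw [← Matrix.mul_assoc Bi Bm Xa, hBiBm, Matrix.one_mul]
  have hcong : IsCongOne 1 ((qi * X.map (Int.cast : ℤ → ℚ) * qm).map f) := by
    rw [hconj]
    exact (hW1.1.mul (isCongOne_one_map_intCast X)).mul hW1.2
  exact forall_exists_intCast_of_isCongOne_one_map _ hcong

end Core

/-! ### §3. Transport of a ring-homomorphism reading -/

section RingHom

variable {O : Type} [Ring O]

/-- An integer matrix is determined by its rational image. [cite: PlatonovRapinchuk1994, §8.1] -/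
private theorem map_intCast_injective {m m' : Type} :
    Function.Injective (fun A : Matrix m m' ℤ => A.map (Int.cast : ℤ → ℚ)) := fun A B h => by
  ext i k
  have := congrFun (congrFun h i) k
  simpa only [Matrix.map_apply, Int.cast_inj] using this

/-- Integer matrices cast to `ℚ` multiply as integer matrices. [cite: PlatonovRapinchuk1994, §8.1] -/
private theorem map_intCast_mul' {m : Type} [Fintype m] (A B : Matrix m m ℤ) :
    (A * B).map (Int.cast : ℤ → ℚ) = A.map (Int.cast : ℤ → ℚ) * B.map (Int.cast : ℤ → ℚ) := by
  ext i j
  simp only [Matrix.map_apply, Matrix.mul_apply, Int.cast_sum, Int.cast_mul]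

/-- **Transport of an integer ring-homomorphism reading along a mover**: for `ρ : O →+* M_{2g}(ℤ)` whose images commute with `B`, and `q`, `r`,
`K` as in `forall_exists_intCast_conj_of_smul_mk_eq`, there is `ρ' : O →+* M_{2g}(ℤ)` with `(ρ' b)_ℚ = q⁻¹ (ρ b)_ℚ q` for all `b` — the
E-line's `Mρ a` from the frame reading `ρ` and the mover `q_a`. [cite: Kottwitz1992, §5 p. 390] [cite: Milne2005ShimuraVarieties, Thm. 6.11 p. 74] -/
theorem exists_ringHom_conj_of_smul_mk_eq (ρ : O →+* Matrix (Fin g ⊕ Fin g) (Fin g ⊕ Fin g) ℤ) (q : ↥(gspRational δ))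
    (B r : ↥(gspFinAdelic δ)) (K : Subgroup ↥(gspFinAdelic δ)) (hK : K ≤ principalLevelSubgroup δ 1) (hr : r ∈ principalLevelSubgroup δ 1)
    (hq : gspRationalToFinAdelic δ q • ((r : ↥(gspFinAdelic δ)) : ↥(gspFinAdelic δ) ⧸ K) = ((B : ↥(gspFinAdelic δ)) : ↥(gspFinAdelic δ) ⧸ K))
    (hcomm : ∀ b, (ρ b).map (Int.cast : ℤ → finAdeleQ) * ((B : GL (Fin g ⊕ Fin g) finAdeleQ) : Matrix (Fin g ⊕ Fin g) (Fin g ⊕ Fin g) finAdeleQ) =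
      ((B : GL (Fin g ⊕ Fin g) finAdeleQ) : Matrix (Fin g ⊕ Fin g) (Fin g ⊕ Fin g) finAdeleQ) * (ρ b).map (Int.cast : ℤ → finAdeleQ)) :
    ∃ ρ' : O →+* Matrix (Fin g ⊕ Fin g) (Fin g ⊕ Fin g) ℤ,
      ∀ b, (ρ' b).map (Int.cast : ℤ → ℚ) =
        (((q⁻¹ : ↥(gspRational δ)) : GL (Fin g ⊕ Fin g) ℚ) : Matrix (Fin g ⊕ Fin g) (Fin g ⊕ Fin g) ℚ) * (ρ b).map (Int.cast : ℤ → ℚ) *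
          (((q : ↥(gspRational δ)) : GL (Fin g ⊕ Fin g) ℚ) : Matrix (Fin g ⊕ Fin g) (Fin g ⊕ Fin g) ℚ) := by
  classical
  set qm : Matrix (Fin g ⊕ Fin g) (Fin g ⊕ Fin g) ℚ := (((q : ↥(gspRational δ)) : GL (Fin g ⊕ Fin g) ℚ) : Matrix (Fin g ⊕ Fin g) (Fin g ⊕ Fin g) ℚ) with hqm
  set qi : Matrix (Fin g ⊕ Fin g) (Fin g ⊕ Fin g) ℚ := (((q⁻¹ : ↥(gspRational δ)) : GL (Fin g ⊕ Fin g) ℚ) : Matrix (Fin g ⊕ Fin g) (Fin g ⊕ Fin g) ℚ) with hqi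
  have hqmqi : qm * qi = 1 := by rw [hqm, hqi, Subgroup.coe_inv, Units.mul_inv]
  -- the rational conjugate as a ring homomorphism
  let φ : Matrix (Fin g ⊕ Fin g) (Fin g ⊕ Fin g) ℤ →+* Matrix (Fin g ⊕ Fin g) (Fin g ⊕ Fin g) ℚ := (Int.castRingHom ℚ).mapMatrix
  have hφ : ∀ A : Matrix (Fin g ⊕ Fin g) (Fin g ⊕ Fin g) ℤ, φ A = A.map (Int.cast : ℤ → ℚ) := fun A => by
    rw [RingHom.mapMatrix_apply, Int.coe_castRingHom]
  let ρQ : O →+* Matrix (Fin g ⊕ Fin g) (Fin g ⊕ Fin g) ℚ :=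
    { toFun := fun b => qi * φ (ρ b) * qm
      map_one' := by rw [map_one, map_one, Matrix.mul_one, hqi, hqm, Subgroup.coe_inv, Units.inv_mul]
      map_mul' := fun x y => by
        rw [map_mul, map_mul]
        calc qi * (φ (ρ x) * φ (ρ y)) * qm = qi * φ (ρ x) * (qm * qi) * φ (ρ y) * qm := by
              rw [hqmqi, Matrix.mul_one]; simp only [Matrix.mul_assoc]
          _ = qi * φ (ρ x) * qm * (qi * φ (ρ y) * qm) := by simp only [Matrix.mul_assoc]
      map_zero' := by rw [map_zero, map_zero, Matrix.mul_zero, Matrix.zero_mul]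
      map_add' := fun x y => by rw [map_add, map_add, Matrix.mul_add, Matrix.add_mul] }
  have hρQ : ∀ b, ρQ b = qi * (ρ b).map (Int.cast : ℤ → ℚ) * qm := fun b => by
    change qi * φ (ρ b) * qm = _
    rw [hφ]
  -- integrality
  have hint : ∀ b, ∃ Z : Matrix (Fin g ⊕ Fin g) (Fin g ⊕ Fin g) ℤ, ρQ b = Z.map (Int.cast : ℤ → ℚ) := by
    intro b
    choose z hz using forall_exists_intCast_conj_of_smul_mk_eq (ρ b) q B r K hK hr hq (hcomm b)
    refine ⟨Matrix.of fun i j => z i j, ?_⟩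
    ext i j
    rw [hρQ, Matrix.map_apply, Matrix.of_apply, ← hz i j]
  choose Z hZ using hint
  have h1 : Z 1 = 1 := map_intCast_injective (by
    change (Z 1).map (Int.cast : ℤ → ℚ) = (1 : Matrix (Fin g ⊕ Fin g) (Fin g ⊕ Fin g) ℤ).map (Int.cast : ℤ → ℚ)
    rw [← hZ, map_one, Matrix.map_one Int.cast Int.cast_zero Int.cast_one])
  have hmul : ∀ x y, Z (x * y) = Z x * Z y := fun x y => map_intCast_injective (by
    change (Z (x * y)).map (Int.cast : ℤ → ℚ) = (Z x * Z y).map (Int.cast : ℤ → ℚ)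
    rw [← hZ, map_mul, hZ, hZ, map_intCast_mul'])
  have h0 : Z 0 = 0 := map_intCast_injective (by
    change (Z 0).map (Int.cast : ℤ → ℚ) = (0 : Matrix (Fin g ⊕ Fin g) (Fin g ⊕ Fin g) ℤ).map (Int.cast : ℤ → ℚ)
    rw [← hZ, map_zero, Matrix.map_zero Int.cast Int.cast_zero])
  have hadd : ∀ x y, Z (x + y) = Z x + Z y := fun x y => map_intCast_injective (by
    change (Z (x + y)).map (Int.cast : ℤ → ℚ) = (Z x + Z y).map (Int.cast : ℤ → ℚ)
    rw [← hZ, map_add, hZ, hZ, Matrix.map_add _ Int.cast_add])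
  let ρ' : O →+* Matrix (Fin g ⊕ Fin g) (Fin g ⊕ Fin g) ℤ :=
    { toFun := Z, map_one' := h1, map_mul' := hmul, map_zero' := h0, map_add' := hadd }
  refine ⟨ρ', fun b => ?_⟩
  change (Z b).map (Int.cast : ℤ → ℚ) = _
  rw [← hZ, hρQ]

end RingHom

/-! ### §4. Rosati survives the transport -/

section Rosati

variable {O : Type} [Ring O]

/-- **ROSATI SURVIVES A `GSp_δ(ℚ)`-CONJUGATION**: if `(ρ b')ᵀ E_δ = E_δ (ρ b)` and `(ρ' x)_ℚ = q⁻¹ (ρ x)_ℚ q` (`x = b, b'`) for a symplectic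
similitude `q` (`qᵀ E q = ν E`), then `(ρ' b')ᵀ E_δ = E_δ (ρ' b)`. [cite: RapoportSmithlingZhang2020Diagonal, §4.1 p. 17] [cite: Milne2005ShimuraVarieties, §6 p. 67] -/
theorem conj_reading_transpose_mul_typeForm (ρ ρ' : O →+* Matrix (Fin g ⊕ Fin g) (Fin g ⊕ Fin g) ℤ) (q : ↥(gspRational δ))
    (hρ' : ∀ b, (ρ' b).map (Int.cast : ℤ → ℚ) =
      (((q⁻¹ : ↥(gspRational δ)) : GL (Fin g ⊕ Fin g) ℚ) : Matrix (Fin g ⊕ Fin g) (Fin g ⊕ Fin g) ℚ) * (ρ b).map (Int.cast : ℤ → ℚ) *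
        (((q : ↥(gspRational δ)) : GL (Fin g ⊕ Fin g) ℚ) : Matrix (Fin g ⊕ Fin g) (Fin g ⊕ Fin g) ℚ))
    (b b' : O) (h : (ρ b')ᵀ * typeForm δ = typeForm δ * ρ b) : (ρ' b')ᵀ * typeForm δ = typeForm δ * ρ' b := by
  set qm : Matrix (Fin g ⊕ Fin g) (Fin g ⊕ Fin g) ℚ := (((q : ↥(gspRational δ)) : GL (Fin g ⊕ Fin g) ℚ) : Matrix (Fin g ⊕ Fin g) (Fin g ⊕ Fin g) ℚ) with hqm
  set qi : Matrix (Fin g ⊕ Fin g) (Fin g ⊕ Fin g) ℚ := (((q⁻¹ : ↥(gspRational δ)) : GL (Fin g ⊕ Fin g) ℚ) : Matrix (Fin g ⊕ Fin g) (Fin g ⊕ Fin g) ℚ) with hqi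
  set E : Matrix (Fin g ⊕ Fin g) (Fin g ⊕ Fin g) ℚ := typeFormOver δ ℚ with hE
  have hqmqi : qm * qi = 1 := by rw [hqm, hqi, Subgroup.coe_inv, Units.mul_inv]
  have hqiqm : qi * qm = 1 := by rw [hqm, hqi, Subgroup.coe_inv, Units.inv_mul]
  -- the similitude relation `qᵀ E q = ν E` and its consequence `qiᵀ E = ν⁻¹ E q`... in the form `qmᵀ E = ν E qi`
  obtain ⟨ν, hν⟩ := mem_similitudeGroupOfForm_iff.1 q.2
  have hν' : qmᵀ * E = (ν : ℚ) • (E * qi) := by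
    calc qmᵀ * E = qmᵀ * E * (qm * qi) := by rw [hqmqi, Matrix.mul_one]
      _ = (qmᵀ * E * qm) * qi := by simp only [Matrix.mul_assoc]
      _ = (ν : ℚ) • (E * qi) := by
          rw [← hqm, ← hE] at hν
          rw [hν, Matrix.smul_mul]
  have hνi : qiᵀ * E = (ν : ℚ)⁻¹ • (E * qm) := by
    -- from `qmᵀ E = ν E qi`: multiply by `qiᵀ` on the left and `qm` on the right
    have h1 : qiᵀ * qmᵀ = 1 := by rw [← Matrix.transpose_mul, hqmqi, Matrix.transpose_one]
    have h2 : qiᵀ * (qmᵀ * E) * qm = E * qm := by rw [← Matrix.mul_assoc, h1, Matrix.one_mul]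
    rw [hν', Matrix.mul_smul, Matrix.smul_mul, Matrix.mul_assoc, Matrix.mul_assoc, hqiqm, Matrix.mul_one] at h2
    rw [← h2, smul_smul, inv_mul_cancel₀ (Units.ne_zero ν), one_smul]
  -- the rational identity
  have hQ : ∀ A : Matrix (Fin g ⊕ Fin g) (Fin g ⊕ Fin g) ℤ,
      (A.map (Int.cast : ℤ → ℚ))ᵀ * E = (Aᵀ * typeForm δ).map (Int.cast : ℤ → ℚ) := fun A => by
    rw [hE, typeFormOver, Int.coe_castRingHom]
    ext i j
    simp only [Matrix.mul_apply, Matrix.map_apply, Matrix.transpose_apply, Int.cast_sum, Int.cast_mul]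
  have hQ' : ∀ A : Matrix (Fin g ⊕ Fin g) (Fin g ⊕ Fin g) ℤ,
      E * A.map (Int.cast : ℤ → ℚ) = (typeForm δ * A).map (Int.cast : ℤ → ℚ) := fun A => by
    rw [hE, typeFormOver, Int.coe_castRingHom]
    ext i j
    simp only [Matrix.mul_apply, Matrix.map_apply, Int.cast_sum, Int.cast_mul]
  have hrat : ((ρ b').map (Int.cast : ℤ → ℚ))ᵀ * E = E * (ρ b).map (Int.cast : ℤ → ℚ) := by rw [hQ, hQ', h]
  have key : ((ρ' b').map (Int.cast : ℤ → ℚ))ᵀ * E = E * (ρ' b).map (Int.cast : ℤ → ℚ) := by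
    rw [hρ' b', hρ' b, Matrix.transpose_mul, Matrix.transpose_mul]
    calc qmᵀ * (((ρ b').map (Int.cast : ℤ → ℚ))ᵀ * qiᵀ) * E
        = qmᵀ * ((ρ b').map (Int.cast : ℤ → ℚ))ᵀ * (qiᵀ * E) := by simp only [Matrix.mul_assoc]
      _ = (ν : ℚ)⁻¹ • (qmᵀ * (((ρ b').map (Int.cast : ℤ → ℚ))ᵀ * E) * qm) := by
          rw [hνi, Matrix.mul_smul]; simp only [Matrix.mul_assoc]
      _ = (ν : ℚ)⁻¹ • ((qmᵀ * E) * (ρ b).map (Int.cast : ℤ → ℚ) * qm) := by rw [hrat]; simp only [Matrix.mul_assoc]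
      _ = E * (qi * (ρ b).map (Int.cast : ℤ → ℚ) * qm) := by
          rw [hν', Matrix.smul_mul, Matrix.smul_mul, smul_smul, inv_mul_cancel₀ (Units.ne_zero ν), one_smul]
          simp only [Matrix.mul_assoc]
  apply map_intCast_injective
  change ((ρ' b')ᵀ * typeForm δ).map (Int.cast : ℤ → ℚ) = (typeForm δ * ρ' b).map (Int.cast : ℤ → ℚ)
  rw [← hQ, ← hQ']
  exact key

end Rosati

/-! ### §5. The real avatar of the transported reading -/

section Real

variable {O : Type} [Ring O]

/-- **`(ρ' b)_ℝ = γ (ρ b)_ℝ γ⁻¹` with `γ = (q_ℝ)⁻¹`** — the transported reading over `ℝ` is the conjugate by the inverse real mover (the `γ N_b γ⁻¹`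
of ★ E2 FILE D `exists_lieAction_charpoly`). [cite: Milne2005ShimuraVarieties, §6 p. 68] [cite: Kottwitz1992, §5 p. 390] -/
theorem conj_reading_map_real (ρ ρ' : O →+* Matrix (Fin g ⊕ Fin g) (Fin g ⊕ Fin g) ℤ) (q : ↥(gspRational δ))
    (hρ' : ∀ b, (ρ' b).map (Int.cast : ℤ → ℚ) =
      (((q⁻¹ : ↥(gspRational δ)) : GL (Fin g ⊕ Fin g) ℚ) : Matrix (Fin g ⊕ Fin g) (Fin g ⊕ Fin g) ℚ) * (ρ b).map (Int.cast : ℤ → ℚ) *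
        (((q : ↥(gspRational δ)) : GL (Fin g ⊕ Fin g) ℚ) : Matrix (Fin g ⊕ Fin g) (Fin g ⊕ Fin g) ℚ))
    (b : O) :
    (ρ' b).map (Int.cast : ℤ → ℝ) =
      ((((gspRationalToReal δ q)⁻¹ : ↥(gspReal δ)) : GL (Fin g ⊕ Fin g) ℝ) : Matrix (Fin g ⊕ Fin g) (Fin g ⊕ Fin g) ℝ) *
        (ρ b).map (Int.cast : ℤ → ℝ) *
        ((((((gspRationalToReal δ q)⁻¹ : ↥(gspReal δ)) : GL (Fin g ⊕ Fin g) ℝ))⁻¹ : GL (Fin g ⊕ Fin g) ℝ) :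
          Matrix (Fin g ⊕ Fin g) (Fin g ⊕ Fin g) ℝ) := by
  have hcast : ∀ A : Matrix (Fin g ⊕ Fin g) (Fin g ⊕ Fin g) ℤ, A.map (Int.cast : ℤ → ℝ) = (A.map (Int.cast : ℤ → ℚ)).map (algebraMap ℚ ℝ) := by
    intro A
    ext i j
    simp only [Matrix.map_apply, map_intCast]
  have hγ : ((((gspRationalToReal δ q)⁻¹ : ↥(gspReal δ)) : GL (Fin g ⊕ Fin g) ℝ) : Matrix (Fin g ⊕ Fin g) (Fin g ⊕ Fin g) ℝ) =
      ((((q⁻¹ : ↥(gspRational δ)) : GL (Fin g ⊕ Fin g) ℚ) : Matrix (Fin g ⊕ Fin g) (Fin g ⊕ Fin g) ℚ)).map (algebraMap ℚ ℝ) := by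
    rw [Subgroup.coe_inv, coe_gspRationalToReal, ← map_inv, ← Subgroup.coe_inv]
    rfl
  have hγi : ((((((gspRationalToReal δ q)⁻¹ : ↥(gspReal δ)) : GL (Fin g ⊕ Fin g) ℝ))⁻¹ : GL (Fin g ⊕ Fin g) ℝ) :
        Matrix (Fin g ⊕ Fin g) (Fin g ⊕ Fin g) ℝ) =
      ((((q : ↥(gspRational δ)) : GL (Fin g ⊕ Fin g) ℚ) : Matrix (Fin g ⊕ Fin g) (Fin g ⊕ Fin g) ℚ)).map (algebraMap ℚ ℝ) := by
    rw [Subgroup.coe_inv, inv_inv]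
    rfl
  rw [hcast, hcast, hρ' b, hγ, hγi]
  simp only [← RingHom.mapMatrix_apply, map_mul]

/-- **The transported reading commutes with the moved complex structure**: if `(ρ b)_ℝ` commutes with `J` then `(ρ' b)_ℝ` commutes with
`conjJ γ J`, `γ = (q_ℝ)⁻¹` (`J(Z_a v) = conjJ (q_a)_ℝ⁻¹ (J v)` in the chart). [cite: Milne2005ShimuraVarieties, §6 p. 68] -/
theorem conj_reading_mul_conjJ_comm (ρ ρ' : O →+* Matrix (Fin g ⊕ Fin g) (Fin g ⊕ Fin g) ℤ) (q : ↥(gspRational δ))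
    (hρ' : ∀ b, (ρ' b).map (Int.cast : ℤ → ℚ) =
      (((q⁻¹ : ↥(gspRational δ)) : GL (Fin g ⊕ Fin g) ℚ) : Matrix (Fin g ⊕ Fin g) (Fin g ⊕ Fin g) ℚ) * (ρ b).map (Int.cast : ℤ → ℚ) *
        (((q : ↥(gspRational δ)) : GL (Fin g ⊕ Fin g) ℚ) : Matrix (Fin g ⊕ Fin g) (Fin g ⊕ Fin g) ℚ))
    (b : O) (J : Matrix (Fin g ⊕ Fin g) (Fin g ⊕ Fin g) ℝ) (hJ : (ρ b).map (Int.cast : ℤ → ℝ) * J = J * (ρ b).map (Int.cast : ℤ → ℝ)) :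
    (ρ' b).map (Int.cast : ℤ → ℝ) * conjJ (((gspRationalToReal δ q)⁻¹ : ↥(gspReal δ)) : GL (Fin g ⊕ Fin g) ℝ) J =
      conjJ (((gspRationalToReal δ q)⁻¹ : ↥(gspReal δ)) : GL (Fin g ⊕ Fin g) ℝ) J * (ρ' b).map (Int.cast : ℤ → ℝ) := by
  have hρ'ℝ := conj_reading_map_real ρ ρ' q hρ' b
  set γ : GL (Fin g ⊕ Fin g) ℝ := (((gspRationalToReal δ q)⁻¹ : ↥(gspReal δ)) : GL (Fin g ⊕ Fin g) ℝ) with hγ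
  set X : Matrix (Fin g ⊕ Fin g) (Fin g ⊕ Fin g) ℝ := (ρ b).map (Int.cast : ℤ → ℝ) with hX
  have hγiγ : ((γ⁻¹ : GL (Fin g ⊕ Fin g) ℝ) : Matrix (Fin g ⊕ Fin g) (Fin g ⊕ Fin g) ℝ) * (γ : Matrix (Fin g ⊕ Fin g) (Fin g ⊕ Fin g) ℝ) = 1 :=
    Units.inv_mul γ
  rw [hρ'ℝ, conjJ_def]
  calc (γ : Matrix (Fin g ⊕ Fin g) (Fin g ⊕ Fin g) ℝ) * X * ((γ⁻¹ : GL (Fin g ⊕ Fin g) ℝ) : Matrix (Fin g ⊕ Fin g) (Fin g ⊕ Fin g) ℝ) *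
        ((γ : Matrix (Fin g ⊕ Fin g) (Fin g ⊕ Fin g) ℝ) * J * ((γ⁻¹ : GL (Fin g ⊕ Fin g) ℝ) : Matrix (Fin g ⊕ Fin g) (Fin g ⊕ Fin g) ℝ))
      = (γ : Matrix (Fin g ⊕ Fin g) (Fin g ⊕ Fin g) ℝ) * X *
          (((γ⁻¹ : GL (Fin g ⊕ Fin g) ℝ) : Matrix (Fin g ⊕ Fin g) (Fin g ⊕ Fin g) ℝ) * (γ : Matrix (Fin g ⊕ Fin g) (Fin g ⊕ Fin g) ℝ)) * J *
          ((γ⁻¹ : GL (Fin g ⊕ Fin g) ℝ) : Matrix (Fin g ⊕ Fin g) (Fin g ⊕ Fin g) ℝ) := by simp only [Matrix.mul_assoc]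
    _ = (γ : Matrix (Fin g ⊕ Fin g) (Fin g ⊕ Fin g) ℝ) * (J * X) * ((γ⁻¹ : GL (Fin g ⊕ Fin g) ℝ) : Matrix (Fin g ⊕ Fin g) (Fin g ⊕ Fin g) ℝ) := by
          rw [hγiγ, Matrix.mul_one, ← hJ]; simp only [Matrix.mul_assoc]
    _ = (γ : Matrix (Fin g ⊕ Fin g) (Fin g ⊕ Fin g) ℝ) * J *
          (((γ⁻¹ : GL (Fin g ⊕ Fin g) ℝ) : Matrix (Fin g ⊕ Fin g) (Fin g ⊕ Fin g) ℝ) * (γ : Matrix (Fin g ⊕ Fin g) (Fin g ⊕ Fin g) ℝ)) * X *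
          ((γ⁻¹ : GL (Fin g ⊕ Fin g) ℝ) : Matrix (Fin g ⊕ Fin g) (Fin g ⊕ Fin g) ℝ) := by rw [hγiγ, Matrix.mul_one]; simp only [Matrix.mul_assoc]
    _ = (γ : Matrix (Fin g ⊕ Fin g) (Fin g ⊕ Fin g) ℝ) * J * ((γ⁻¹ : GL (Fin g ⊕ Fin g) ℝ) : Matrix (Fin g ⊕ Fin g) (Fin g ⊕ Fin g) ℝ) *
          ((γ : Matrix (Fin g ⊕ Fin g) (Fin g ⊕ Fin g) ℝ) * X * ((γ⁻¹ : GL (Fin g ⊕ Fin g) ℝ) : Matrix (Fin g ⊕ Fin g) (Fin g ⊕ Fin g) ℝ)) := by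
          simp only [Matrix.mul_assoc]

end Real

end Literature.AlgebraicGeometry.ModuliOfAbelianVarieties

end
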